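import Mathlib
import HarnessLib
import Summits.ValiantsHypothesis.ValiantsHypothesis.Theorems.LacunarySymmetroidMatrixDescartesOsculationLawTwoKSupport
import Summits.ValiantsHypothesis.ValiantsHypothesis.Theorems.LacunarySymmetroidMatrixDescartesOsculationLawCuspQuarticCountLow
import Summits.ValiantsHypothesis.ValiantsHypothesis.Theorems.LacunarySymmetroidMatrixDescartesOsculationLawCuspQuarticCountHighLin
import Summits.ValiantsHypothesis.ValiantsHypothesis.Theorems.LacunarySymmetroidMatrixDescartesOsculationLawCuspQuarticCountHigh

/-!
# ValiantsHypothesis / LacunarySymmetroid — crux `MatrixDescartes` (stmt-ValiantsHypothesis-18050, V1),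
# line «osculation-law»: the MONIC QUARTIC cusp curve — the count, assembled, in numeric form

The COUNT HALF of the `(4,0)` piece of the `m = 4` rung (desk RULING #260 (b)), assembled from the three regime
files (`quartic_low_ncard_le` — `R₃ ≡ 0`; `quartic_high_lin_ncard_le` — `R₃ ≢ 0`, `ℓ₂ ≡ 0`; `quartic_high_ncard_le`
— `R₃ ≢ 0`, `ℓ₂ ≢ 0`) and the support bookkeeping (`…OsculationLawTwoKSupport` tools): for polynomials
`σ₁ … σ₄, R₃ … R₀ ∈ ℝ[X]` with `supp σₖ ⊆ k•E`, `supp R₃ ⊆ 9•E, …, supp R₀ ⊆ 12•E` (the weights delivered by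
`…CuspQuarticSupportHigh/Low` for the Hessian remainders of `OsculationCuspQuartic.hess_reduce_poly4`) and `|E| ≤ K`,
a finite set `osc` of positive points of the quartic curve on which the cubic remainder vanishes (`hout`), closed under
the converse (`hin`), with `Φ(t,·)` real-rooted (`hreal`), has **`#osc ≤ 22·K¹²⁴`** (`quartic_curve_ncard_le_pow`).
Weights: `ℓ₂,ℓ₁,ℓ₀ : 20,21,22`, `m₁,m₀ : 51,52`, `N : 124`, `N₁ : 75`, `n₁,n₀ : 33,34`, `N₂ : 78`, `N₃ : 48`.
What is still open for `(4,0)`: the PENCIL side (`σₖ` = signed elementary symmetric functions of the `4 × 4` pencil,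
their supports, real-rootedness from symmetry — val-lit-p5 g11's `OsculationLetter.insertionPoly_rank` tools) and the
link `H = logHessian(Φ)` via `eval_logHessian_Phi4` + `hess_reduce_poly4`, i.e. the file `osc_four_zero`.

Honest framing: helper count for a located rung piece of an UNREGISTERED V1 law line; `OsculationLaw`,
`PeelInequality`, `MatrixDescartes`, Conjecture B and `VP ≠ VNP` are OPEN / NOT proved.  No definitions, no named facts.
-/

-- `Summit.ValiantsHypothesis.ValiantsHypothesis.…` is the tree's mandated single-conjunct layout (Sub = Summit).
set_option linter.dupNamespace false

noncomputable section

namespace Summit.ValiantsHypothesis.ValiantsHypothesis.Theorems.LacunarySymmetroidMatrixDescartes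

open Polynomial Set
open scoped BigOperators Pointwise
open OsculationCusp

namespace OsculationCuspQuartic

/-! ### Supports of the cascade polynomials (abstract in the remainders) -/

/-- `supp ℓ₂ ⊆ 20 • E`. [folklore] -/
theorem supp_l2q {σ₁ σ₂ R₃ R₂ R₁ : ℝ[X]} {E : Finset ℕ} (h1 : σ₁.support ⊆ 1 • E) (h2 : σ₂.support ⊆ 2 • E)
    (hR3 : R₃.support ⊆ 9 • E) (hR2 : R₂.support ⊆ 10 • E) (hR1 : R₁.support ⊆ 11 • E) :
    (σ₂ * R₃ ^ 2 - R₁ * R₃ - σ₁ * R₂ * R₃ + R₂ ^ 2).support ⊆ 20 • E :=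
  supp_add (supp_sub (supp_sub (supp_cast (supp_mul h2 (supp_pow hR3 2 (by norm_num))) (by norm_num))
    (supp_cast (supp_mul hR1 hR3) (by norm_num))) (supp_cast (supp_mul (supp_mul h1 hR2) hR3) (by norm_num)))
    (supp_cast (supp_pow hR2 2 (by norm_num)) (by norm_num))

/-- `supp ℓ₁ ⊆ 21 • E`. [folklore] -/
theorem supp_l1q {σ₁ σ₃ R₃ R₂ R₁ R₀ : ℝ[X]} {E : Finset ℕ} (h1 : σ₁.support ⊆ 1 • E) (h3 : σ₃.support ⊆ 3 • E)
    (hR3 : R₃.support ⊆ 9 • E) (hR2 : R₂.support ⊆ 10 • E) (hR1 : R₁.support ⊆ 11 • E)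
    (hR0 : R₀.support ⊆ 12 • E) :
    (σ₃ * R₃ ^ 2 - R₀ * R₃ - σ₁ * R₁ * R₃ + R₁ * R₂).support ⊆ 21 • E :=
  supp_add (supp_sub (supp_sub (supp_cast (supp_mul h3 (supp_pow hR3 2 (by norm_num))) (by norm_num))
    (supp_cast (supp_mul hR0 hR3) (by norm_num))) (supp_cast (supp_mul (supp_mul h1 hR1) hR3) (by norm_num)))
    (supp_cast (supp_mul hR1 hR2) (by norm_num))

/-- `supp ℓ₀ ⊆ 22 • E`. [folklore] -/
theorem supp_l0q {σ₁ σ₄ R₃ R₂ R₀ : ℝ[X]} {E : Finset ℕ} (h1 : σ₁.support ⊆ 1 • E) (h4 : σ₄.support ⊆ 4 • E)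
    (hR3 : R₃.support ⊆ 9 • E) (hR2 : R₂.support ⊆ 10 • E) (hR0 : R₀.support ⊆ 12 • E) :
    (σ₄ * R₃ ^ 2 - σ₁ * R₀ * R₃ + R₀ * R₂).support ⊆ 22 • E :=
  supp_add (supp_sub (supp_cast (supp_mul h4 (supp_pow hR3 2 (by norm_num))) (by norm_num))
    (supp_cast (supp_mul (supp_mul h1 hR0) hR3) (by norm_num))) (supp_cast (supp_mul hR0 hR2) (by norm_num))

/-- `supp m₁ ⊆ 51 • E`. [folklore] -/
theorem supp_m1q {R₃ R₂ R₁ P₂ P₁ P₀ : ℝ[X]} {E : Finset ℕ} (hR3 : R₃.support ⊆ 9 • E)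
    (hR2 : R₂.support ⊆ 10 • E) (hR1 : R₁.support ⊆ 11 • E) (hP2 : P₂.support ⊆ 20 • E)
    (hP1 : P₁.support ⊆ 21 • E) (hP0 : P₀.support ⊆ 22 • E) :
    (R₁ * P₂ ^ 2 - R₃ * P₀ * P₂ - R₂ * P₁ * P₂ + R₃ * P₁ ^ 2).support ⊆ 51 • E :=
  supp_add (supp_sub (supp_sub (supp_cast (supp_mul hR1 (supp_pow hP2 2 (by norm_num))) (by norm_num))
    (supp_cast (supp_mul (supp_mul hR3 hP0) hP2) (by norm_num)))
    (supp_cast (supp_mul (supp_mul hR2 hP1) hP2) (by norm_num)))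
    (supp_cast (supp_mul hR3 (supp_pow hP1 2 (by norm_num))) (by norm_num))

/-- `supp m₀ ⊆ 52 • E`. [folklore] -/
theorem supp_m0q {R₃ R₂ R₀ P₂ P₁ P₀ : ℝ[X]} {E : Finset ℕ} (hR3 : R₃.support ⊆ 9 • E)
    (hR2 : R₂.support ⊆ 10 • E) (hR0 : R₀.support ⊆ 12 • E) (hP2 : P₂.support ⊆ 20 • E)
    (hP1 : P₁.support ⊆ 21 • E) (hP0 : P₀.support ⊆ 22 • E) :
    (R₀ * P₂ ^ 2 - R₂ * P₀ * P₂ + R₃ * P₀ * P₁).support ⊆ 52 • E :=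
  supp_add (supp_sub (supp_cast (supp_mul hR0 (supp_pow hP2 2 (by norm_num))) (by norm_num))
    (supp_cast (supp_mul (supp_mul hR2 hP0) hP2) (by norm_num)))
    (supp_cast (supp_mul (supp_mul hR3 hP0) hP1) (by norm_num))

/-- `supp N ⊆ 124 • E` for `N = ℓ₂m₀² − ℓ₁m₀m₁ + ℓ₀m₁²`. [folklore] -/
theorem supp_Nq {P₂ P₁ P₀ M₁ M₀ : ℝ[X]} {E : Finset ℕ} (hP2 : P₂.support ⊆ 20 • E)
    (hP1 : P₁.support ⊆ 21 • E) (hP0 : P₀.support ⊆ 22 • E) (hM1 : M₁.support ⊆ 51 • E)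
    (hM0 : M₀.support ⊆ 52 • E) :
    (P₂ * M₀ ^ 2 - P₁ * M₀ * M₁ + P₀ * M₁ ^ 2).support ⊆ 124 • E :=
  supp_add (supp_sub (supp_cast (supp_mul hP2 (supp_pow hM0 2 (by norm_num))) (by norm_num))
    (supp_cast (supp_mul (supp_mul hP1 hM0) hM1) (by norm_num)))
    (supp_cast (supp_mul hP0 (supp_pow hM1 2 (by norm_num))) (by norm_num))

/-- `supp N₁ ⊆ 75 • E` for `N₁ = R₀ℓ₁³ − R₁ℓ₀ℓ₁² + R₂ℓ₀²ℓ₁ − R₃ℓ₀³`. [folklore] -/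
theorem supp_N1q {R₃ R₂ R₁ R₀ P₁ P₀ : ℝ[X]} {E : Finset ℕ} (hR3 : R₃.support ⊆ 9 • E)
    (hR2 : R₂.support ⊆ 10 • E) (hR1 : R₁.support ⊆ 11 • E) (hR0 : R₀.support ⊆ 12 • E)
    (hP1 : P₁.support ⊆ 21 • E) (hP0 : P₀.support ⊆ 22 • E) :
    (R₀ * P₁ ^ 3 - R₁ * P₀ * P₁ ^ 2 + R₂ * P₀ ^ 2 * P₁ - R₃ * P₀ ^ 3).support ⊆ 75 • E :=
  supp_sub (supp_add (supp_sub (supp_cast (supp_mul hR0 (supp_pow hP1 3 (by norm_num))) (by norm_num))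
    (supp_cast (supp_mul (supp_mul hR1 hP0) (supp_pow hP1 2 (by norm_num))) (by norm_num)))
    (supp_cast (supp_mul (supp_mul hR2 (supp_pow hP0 2 (by norm_num))) hP1) (by norm_num)))
    (supp_cast (supp_mul hR3 (supp_pow hP0 3 (by norm_num))) (by norm_num))

/-- `supp n₁ ⊆ 33 • E` (quadratic-remainder regime). [folklore] -/
theorem supp_n1q {σ₁ σ₂ σ₃ R₂ R₁ R₀ : ℝ[X]} {E : Finset ℕ} (h1 : σ₁.support ⊆ 1 • E) (h2 : σ₂.support ⊆ 2 • E)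
    (h3 : σ₃.support ⊆ 3 • E) (hR2 : R₂.support ⊆ 10 • E) (hR1 : R₁.support ⊆ 11 • E)
    (hR0 : R₀.support ⊆ 12 • E) :
    (σ₃ * R₂ ^ 3 - σ₁ * R₀ * R₂ ^ 2 - σ₂ * R₁ * R₂ ^ 2 + 2 * R₀ * R₁ * R₂ + σ₁ * R₁ ^ 2 * R₂ - R₁ ^ 3).support
      ⊆ 33 • E :=
  supp_sub (supp_add (supp_add (supp_sub (supp_sub (supp_cast (supp_mul h3 (supp_pow hR2 3 (by norm_num))) (by norm_num))
    (supp_cast (supp_mul (supp_mul h1 hR0) (supp_pow hR2 2 (by norm_num))) (by norm_num)))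
    (supp_cast (supp_mul (supp_mul h2 hR1) (supp_pow hR2 2 (by norm_num))) (by norm_num)))
    (supp_cast (supp_mul (supp_mul (supp_ofNat_mul 2 hR0) hR1) hR2) (by norm_num)))
    (supp_cast (supp_mul (supp_mul h1 (supp_pow hR1 2 (by norm_num))) hR2) (by norm_num)))
    (supp_cast (supp_pow hR1 3 (by norm_num)) (by norm_num))

/-- `supp n₀ ⊆ 34 • E` (quadratic-remainder regime). [folklore] -/
theorem supp_n0q {σ₁ σ₂ σ₄ R₂ R₁ R₀ : ℝ[X]} {E : Finset ℕ} (h1 : σ₁.support ⊆ 1 • E) (h2 : σ₂.support ⊆ 2 • E)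
    (h4 : σ₄.support ⊆ 4 • E) (hR2 : R₂.support ⊆ 10 • E) (hR1 : R₁.support ⊆ 11 • E)
    (hR0 : R₀.support ⊆ 12 • E) :
    (σ₄ * R₂ ^ 3 - σ₂ * R₀ * R₂ ^ 2 + R₀ ^ 2 * R₂ + σ₁ * R₀ * R₁ * R₂ - R₀ * R₁ ^ 2).support ⊆ 34 • E :=
  supp_sub (supp_add (supp_add (supp_sub (supp_cast (supp_mul h4 (supp_pow hR2 3 (by norm_num))) (by norm_num))
    (supp_cast (supp_mul (supp_mul h2 hR0) (supp_pow hR2 2 (by norm_num))) (by norm_num)))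
    (supp_cast (supp_mul (supp_pow hR0 2 (by norm_num)) hR2) (by norm_num)))
    (supp_cast (supp_mul (supp_mul (supp_mul h1 hR0) hR1) hR2) (by norm_num)))
    (supp_cast (supp_mul hR0 (supp_pow hR1 2 (by norm_num))) (by norm_num))

/-- `supp N₂ ⊆ 78 • E` for `N₂ = R₂n₀² − R₁n₀n₁ + R₀n₁²`. [folklore] -/
theorem supp_N2q {R₂ R₁ R₀ L₁ L₀ : ℝ[X]} {E : Finset ℕ} (hR2 : R₂.support ⊆ 10 • E)
    (hR1 : R₁.support ⊆ 11 • E) (hR0 : R₀.support ⊆ 12 • E) (hL1 : L₁.support ⊆ 33 • E)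
    (hL0 : L₀.support ⊆ 34 • E) :
    (R₂ * L₀ ^ 2 - R₁ * L₀ * L₁ + R₀ * L₁ ^ 2).support ⊆ 78 • E :=
  supp_add (supp_sub (supp_cast (supp_mul hR2 (supp_pow hL0 2 (by norm_num))) (by norm_num))
    (supp_cast (supp_mul (supp_mul hR1 hL0) hL1) (by norm_num)))
    (supp_cast (supp_mul hR0 (supp_pow hL1 2 (by norm_num))) (by norm_num))

/-- `supp N₃ ⊆ 48 • E` for `N₃ = σ₄R₁⁴ − σ₃R₀R₁³ + σ₂R₀²R₁² − σ₁R₀³R₁ + R₀⁴`. [folklore] -/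
theorem supp_N3q {σ₁ σ₂ σ₃ σ₄ R₁ R₀ : ℝ[X]} {E : Finset ℕ} (h1 : σ₁.support ⊆ 1 • E) (h2 : σ₂.support ⊆ 2 • E)
    (h3 : σ₃.support ⊆ 3 • E) (h4 : σ₄.support ⊆ 4 • E) (hR1 : R₁.support ⊆ 11 • E)
    (hR0 : R₀.support ⊆ 12 • E) :
    (σ₄ * R₁ ^ 4 - σ₃ * R₀ * R₁ ^ 3 + σ₂ * R₀ ^ 2 * R₁ ^ 2 - σ₁ * R₀ ^ 3 * R₁ + R₀ ^ 4).support ⊆ 48 • E :=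
  supp_add (supp_sub (supp_add (supp_sub (supp_cast (supp_mul h4 (supp_pow hR1 4 (by norm_num))) (by norm_num))
    (supp_cast (supp_mul (supp_mul h3 hR0) (supp_pow hR1 3 (by norm_num))) (by norm_num)))
    (supp_cast (supp_mul (supp_mul h2 (supp_pow hR0 2 (by norm_num))) (supp_pow hR1 2 (by norm_num))) (by norm_num)))
    (supp_cast (supp_mul (supp_mul h1 (supp_pow hR0 3 (by norm_num))) hR1) (by norm_num)))
    (supp_cast (supp_pow hR0 4 (by norm_num)) (by norm_num))

/-- Power bookkeeping: `K^i ≤ K^124` for `1 ≤ i ≤ 124`. [folklore] -/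
theorem pow_le_pow_124 (K i : ℕ) (h1 : 1 ≤ i) (h124 : i ≤ 124) : K ^ i ≤ K ^ 124 := by
  rcases Nat.eq_zero_or_pos K with hK | hK
  · subst hK; rw [zero_pow (by omega), zero_pow (by omega)]
  · exact Nat.pow_le_pow_right hK h124

/-! ### The count, assembled -/

set_option maxHeartbeats 1600000 in
/-- **Monic quartic cusp curve — the count in numeric form: `#osc ≤ 22·K¹²⁴`.**  See the module docstring.
[folklore] -/
theorem quartic_curve_ncard_le_pow {σ₁ σ₂ σ₃ σ₄ R₃ R₂ R₁ R₀ : ℝ[X]} {E : Finset ℕ} {K : ℕ}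
    (osc : Set (Fin 2 → ℝ)) (hEK : E.card ≤ K)
    (h1 : σ₁.support ⊆ 1 • E) (h2 : σ₂.support ⊆ 2 • E) (h3 : σ₃.support ⊆ 3 • E) (h4 : σ₄.support ⊆ 4 • E)
    (hR3 : R₃.support ⊆ 9 • E) (hR2 : R₂.support ⊆ 10 • E) (hR1 : R₁.support ⊆ 11 • E)
    (hR0 : R₀.support ⊆ 12 • E)
    (hout : ∀ p ∈ osc, 0 < p 0 ∧ 0 < p 1 ∧
      p 1 ^ 4 + p 1 ^ 3 * σ₁.eval (p 0) + p 1 ^ 2 * σ₂.eval (p 0) + p 1 * σ₃.eval (p 0) + σ₄.eval (p 0) = 0 ∧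
      R₃.eval (p 0) * p 1 ^ 3 + R₂.eval (p 0) * p 1 ^ 2 + R₁.eval (p 0) * p 1 + R₀.eval (p 0) = 0)
    (hin : ∀ t b : ℝ, 0 < t → 0 < b →
      b ^ 4 + b ^ 3 * σ₁.eval t + b ^ 2 * σ₂.eval t + b * σ₃.eval t + σ₄.eval t = 0 →
      R₃.eval t * b ^ 3 + R₂.eval t * b ^ 2 + R₁.eval t * b + R₀.eval t = 0 → (![t, b] : Fin 2 → ℝ) ∈ osc)
    (hreal : ∀ t : ℝ, ∃ μ₁ μ₂ μ₃ μ₄ : ℝ, ∀ b : ℝ,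
      b ^ 4 + b ^ 3 * σ₁.eval t + b ^ 2 * σ₂.eval t + b * σ₃.eval t + σ₄.eval t
        = (b - μ₁) * (b - μ₂) * (b - μ₃) * (b - μ₄))
    (hfin : osc.Finite) :
    osc.ncard ≤ 22 * K ^ 124 := by
  have cR3 := (card_support_le_of_subset_nsmul hR3).trans (Nat.pow_le_pow_left hEK 9)
  have cR2 := (card_support_le_of_subset_nsmul hR2).trans (Nat.pow_le_pow_left hEK 10)
  have cR1 := (card_support_le_of_subset_nsmul hR1).trans (Nat.pow_le_pow_left hEK 11)
  have cR0 := (card_support_le_of_subset_nsmul hR0).trans (Nat.pow_le_pow_left hEK 12)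
  have e9 := pow_le_pow_124 K 9 (by norm_num) (by norm_num)
  have e10 := pow_le_pow_124 K 10 (by norm_num) (by norm_num)
  have e11 := pow_le_pow_124 K 11 (by norm_num) (by norm_num)
  have e12 := pow_le_pow_124 K 12 (by norm_num) (by norm_num)
  by_cases hR3z : R₃ = 0
  · /- `R₃ ≡ 0`: quadratic-remainder regimes -/
    have hout' : ∀ p ∈ osc, 0 < p 0 ∧ 0 < p 1 ∧
        p 1 ^ 4 + p 1 ^ 3 * σ₁.eval (p 0) + p 1 ^ 2 * σ₂.eval (p 0) + p 1 * σ₃.eval (p 0) + σ₄.eval (p 0) = 0 ∧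
        R₂.eval (p 0) * p 1 ^ 2 + R₁.eval (p 0) * p 1 + R₀.eval (p 0) = 0 := by
      intro p hp
      obtain ⟨a, b, c, d⟩ := hout p hp
      refine ⟨a, b, c, ?_⟩
      rw [hR3z, eval_zero, zero_mul, zero_add] at d
      exact d
    have hin' : ∀ t b : ℝ, 0 < t → 0 < b →
        b ^ 4 + b ^ 3 * σ₁.eval t + b ^ 2 * σ₂.eval t + b * σ₃.eval t + σ₄.eval t = 0 →
        R₂.eval t * b ^ 2 + R₁.eval t * b + R₀.eval t = 0 → (![t, b] : Fin 2 → ℝ) ∈ osc := by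
      intro t b ht hb hΦ hq
      refine hin t b ht hb hΦ ?_
      rw [hR3z, eval_zero, zero_mul, zero_add]
      exact hq
    have hc := quartic_low_ncard_le σ₁ σ₂ σ₃ σ₄ R₂ R₁ R₀ osc hout' hin' hreal hfin
    have hn1 := supp_n1q h1 h2 h3 hR2 hR1 hR0
    have hn0 := supp_n0q h1 h2 h4 hR2 hR1 hR0
    have cN2 := (card_support_le_of_subset_nsmul (supp_N2q hR2 hR1 hR0 hn1 hn0)).trans (Nat.pow_le_pow_left hEK 78)
    have cN3 := (card_support_le_of_subset_nsmul (supp_N3q h1 h2 h3 h4 hR1 hR0)).trans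
      (Nat.pow_le_pow_left hEK 48)
    have cn1 := (card_support_le_of_subset_nsmul hn1).trans (Nat.pow_le_pow_left hEK 33)
    have cn0 := (card_support_le_of_subset_nsmul hn0).trans (Nat.pow_le_pow_left hEK 34)
    have e78 := pow_le_pow_124 K 78 (by norm_num) (by norm_num)
    have e48 := pow_le_pow_124 K 48 (by norm_num) (by norm_num)
    have e33 := pow_le_pow_124 K 33 (by norm_num) (by norm_num)
    have e34 := pow_le_pow_124 K 34 (by norm_num) (by norm_num)
    omega
  · have hP2 := supp_l2q h1 h2 hR3 hR2 hR1
    have hP1 := supp_l1q h1 h3 hR3 hR2 hR1 hR0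
    have hP0 := supp_l0q h1 h4 hR3 hR2 hR0
    have cP2 := (card_support_le_of_subset_nsmul hP2).trans (Nat.pow_le_pow_left hEK 20)
    have cP1 := (card_support_le_of_subset_nsmul hP1).trans (Nat.pow_le_pow_left hEK 21)
    have cP0 := (card_support_le_of_subset_nsmul hP0).trans (Nat.pow_le_pow_left hEK 22)
    have e20 := pow_le_pow_124 K 20 (by norm_num) (by norm_num)
    have e21 := pow_le_pow_124 K 21 (by norm_num) (by norm_num)
    have e22 := pow_le_pow_124 K 22 (by norm_num) (by norm_num)
    by_cases hl2z : σ₂ * R₃ ^ 2 - R₁ * R₃ - σ₁ * R₂ * R₃ + R₂ ^ 2 = 0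
    · /- `ℓ₂ ≡ 0`: linear second remainder -/
      have hc := quartic_high_lin_ncard_le σ₁ σ₂ σ₃ σ₄ R₃ R₂ R₁ R₀ osc hR3z hl2z hout hin hreal hfin
      have cN1 := (card_support_le_of_subset_nsmul (supp_N1q hR3 hR2 hR1 hR0 hP1 hP0)).trans
        (Nat.pow_le_pow_left hEK 75)
      have e75 := pow_le_pow_124 K 75 (by norm_num) (by norm_num)
      omega
    · /- `ℓ₂ ≢ 0`: two-level cascade -/
      have hc := quartic_high_ncard_le σ₁ σ₂ σ₃ σ₄ R₃ R₂ R₁ R₀ osc hR3z hl2z hout hin hreal hfin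
      have hM1 := supp_m1q hR3 hR2 hR1 hP2 hP1 hP0
      have hM0 := supp_m0q hR3 hR2 hR0 hP2 hP1 hP0
      have cN := (card_support_le_of_subset_nsmul (supp_Nq hP2 hP1 hP0 hM1 hM0)).trans
        (Nat.pow_le_pow_left hEK 124)
      have cM1 := (card_support_le_of_subset_nsmul hM1).trans (Nat.pow_le_pow_left hEK 51)
      have cM0 := (card_support_le_of_subset_nsmul hM0).trans (Nat.pow_le_pow_left hEK 52)
      have e51 := pow_le_pow_124 K 51 (by norm_num) (by norm_num)
      have e52 := pow_le_pow_124 K 52 (by norm_num) (by norm_num)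
      omega

end OsculationCuspQuartic

end Summit.ValiantsHypothesis.ValiantsHypothesis.Theorems.LacunarySymmetroidMatrixDescartes
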